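import Summits.QuantumFields.QCD.Theorems.HeatSlicedQuarksQuarkLoopCoefficientTorusToPlaneAux
import Summits.QuantumFields.QCD.Theorems.HeatSlicedQuarksQuarkLoopCoefficientTorusToPlaneAuxB
import Summits.QuantumFields.QCD.Theorems.HeatSlicedQuarksQuarkLoopCoefficientTorusToPlaneAuxE

/-!
# Stub `stub_torusToPlane` of line `Sketch` (crux `QuarkLoopCoefficient`, item stmt-QuantumFields-16786): from the torus to the plane

**Twisted periodization of the torus heat kernel.**  For a Cartan-diagonal `SU(3)` lattice gauge
field `U` on `(ℤ/L)⁴` with plaquette `diag(e^{iθ}, e^{−iθ}, 1)` in the `(0,1)` plane and all other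
plaquettes trivial, every `t`, site `x`, colour `a` and spin `α`:

  `exp(−t D_Wᴴ D_W)((x,a,α),(x,a,α)) = Σ_{n ∈ ℤ⁴} c_n · (symHeat (charge a θ) t (L n))_{αα}`,
  `c_0 = 1`, `|c_n| = 1`.

## Proof (assembly of the helper files `…TorusToPlaneAux`, `AuxB`–`AuxE`)

1. *Colour decoupling and periodization* (`hasSum_heatKer_deck`, AuxC–E): the links are diagonal, so
   `D_W` is colour-diagonal with colour-`a` block the abelian Wilson operator of the phases
   `u_a = U_{aa}`; pulling back to the universal cover `ℤ⁴` and pushing the exponential series through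
   the fibre sums gives `K_U(t)((π x̃,a,α),(π x̃,a,α)) = Σ_n heatKer ũ_a t x̃ (x̃ + Ln)_{αα}`.
2. *Gauge classification* (`pullback_plaquette` below, `exists_gauge_symLink`, AuxB): the pulled-back
   phases `ũ_a` are unimodular with plaquette `e^{i·charge a θ}` in the `(0,1)` plane and `1`
   elsewhere — the plaquettes of `symLink (charge a θ)` — hence `ũ_a = g · symLink · conj g(· + e_μ)`
   with `|g| = 1` (discrete Poincaré lemma on `ℤ⁴`).
3. *Covariance* (`heatKer_gauge`, `heatKer_symLink`, Aux): `heatKer ũ_a t x̃ z̃ = g(x̃) conj g(z̃) ·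
   heatKer (symLink q) t x̃ z̃ = g(x̃) conj g(z̃) Ω(x̃, z̃ − x̃) · symHeat q t (z̃ − x̃)`; at `z̃ = x̃ + Ln`
   this is `c_n · symHeat q t (Ln)` with the unit phase `c_n = g(x̃) conj g(x̃+Ln) Ω(x̃, Ln)`, `c_0 = 1`.

No named facts; Mathlib + the tree's `wilsonDirac`, `plaquetteHolonomy`, `fundamentalRep`.
-/

noncomputable section

namespace Summit.QuantumFields.QCD.Cruxes.QuarkLoopCoefficient.Sketch

open Summit.QuantumFields.QCD.Theorems.QuarkLoopCoefficient
open Literature.MathematicalPhysics.QuantumLattice Literature.MathematicalPhysics.QuantumFieldTheory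
open Literature.Probability.LatticeModels (Site TorusSite)
open Summit.QuantumFields.QCD.Cruxes.QuarkLoopCoefficient.Sketch.HeatSeries
open scoped Matrix ComplexConjugate

namespace TorusToPlane

/-! ### Cartan-diagonal fields: diagonal entries of links and plaquettes -/

section Diagonal

variable {L : ℕ} (U : GaugeConfig 4 L (Matrix.specialUnitaryGroup (Fin 3) ℂ))

/-- Diagonal entry of a product with an off-diagonal-free left factor. -/
theorem diag_mul_apply_same {A B : Matrix (Fin 3) (Fin 3) ℂ} (hA : ∀ i j, i ≠ j → A i j = 0) (i : Fin 3) :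
    (A * B) i i = A i i * B i i := by
  rw [Matrix.mul_apply, Finset.sum_eq_single i]
  · intro k _ hk; rw [hA i k (Ne.symm hk), zero_mul]
  · intro h; exact absurd (Finset.mem_univ i) h

/-- Products of off-diagonal-free matrices are off-diagonal-free. -/
theorem diag_mul_offdiag {A B : Matrix (Fin 3) (Fin 3) ℂ} (hA : ∀ i j, i ≠ j → A i j = 0)
    (hB : ∀ i j, i ≠ j → B i j = 0) : ∀ i j, i ≠ j → (A * B) i j = 0 := by
  intro i j hij
  rw [Matrix.mul_apply]
  refine Finset.sum_eq_zero fun k _ => ?_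
  by_cases hik : i = k
  · subst hik; rw [hB i j hij, mul_zero]
  · rw [hA i k hik, zero_mul]

/-- **Diagonal entries of the plaquettes of a Cartan-diagonal field** are the abelian plaquettes of
the diagonal phases: `(U_p)_{aa} = u(y,μ) u(y+e_μ,ν) conj u(y+e_ν,μ) conj u(y,ν)`, `u = U_{aa}`. -/
theorem plaquette_apply_diag
    (hdiag : ∀ (e : Edge 4 L) (i j : Fin 3), i ≠ j → (fundamentalRep (Fin 3)) (U e) i j = 0)
    (y : TorusSite 4 L) (μ ν : Fin 4) (a : Fin 3) :
    (fundamentalRep (Fin 3)) (plaquetteHolonomy U y μ ν) a a =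
      (fundamentalRep (Fin 3)) (U (y, μ)) a a * (fundamentalRep (Fin 3)) (U (y + Pi.single μ 1, ν)) a a *
        conj ((fundamentalRep (Fin 3)) (U (y + Pi.single ν 1, μ)) a a) *
        conj ((fundamentalRep (Fin 3)) (U (y, ν)) a a) := by
  -- entries of the inverse of a special unitary link: `(g⁻¹)_{ij} = conj g_{ji}` (definitional)
  have hinv_apply : ∀ (e : Edge 4 L) (i j : Fin 3),
      (fundamentalRep (Fin 3)) (U e)⁻¹ i j = conj ((fundamentalRep (Fin 3)) (U e) j i) := fun _ _ _ => rfl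
  have hinv : ∀ e : Edge 4 L, ∀ i j : Fin 3, i ≠ j → (fundamentalRep (Fin 3)) (U e)⁻¹ i j = 0 := by
    intro e i j hij
    rw [hinv_apply, hdiag e j i (Ne.symm hij), map_zero]
  simp only [plaquetteHolonomy, Literature.MathematicalPhysics.QuantumFieldTheory.Site.shift, map_mul]
  rw [diag_mul_apply_same (diag_mul_offdiag (diag_mul_offdiag (hdiag _) (hdiag _)) (hinv _)),
    diag_mul_apply_same (diag_mul_offdiag (hdiag _) (hdiag _)),
    diag_mul_apply_same (hdiag _), hinv_apply, hinv_apply]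

/-- The diagonal entries of a Cartan-diagonal special unitary link are unimodular. -/
theorem norm_apply_diag
    (hdiag : ∀ (e : Edge 4 L) (i j : Fin 3), i ≠ j → (fundamentalRep (Fin 3)) (U e) i j = 0)
    (e : Edge 4 L) (a : Fin 3) : ‖(fundamentalRep (Fin 3)) (U e) a a‖ = 1 := by
  have hU : (fundamentalRep (Fin 3)) (U e) * star ((fundamentalRep (Fin 3)) (U e)) = 1 := (U e).prop.1.2
  have h := congrFun (congrFun hU a) a
  rw [diag_mul_apply_same (hdiag e), Matrix.star_apply, Complex.star_def, Matrix.one_apply_eq,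
    Complex.mul_conj'] at h
  have h' : ‖(fundamentalRep (Fin 3)) (U e) a a‖ ^ 2 = 1 := by exact_mod_cast h
  nlinarith [norm_nonneg ((fundamentalRep (Fin 3)) (U e) a a)]

/-- **The pulled-back colour phases carry the flux of the symmetric gauge.**  Under the crux
hypotheses (Cartan-diagonal links, plaquette `diag(e^{iθ}, e^{−iθ}, 1)` in the `(0,1)` plane, all
other plaquettes trivial), the colour-`a` phases pulled back to `ℤ⁴` have plaquette
`e^{i·charge a θ}` in the `(0,1)` plane, `e^{−i·charge a θ}` in the `(1,0)` orientation, and `1`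
in every other plane — the plaquettes of `symLink (charge a θ)`. -/
theorem pullback_plaquette [NeZero L] (θ : ℝ)
    (hdiag : ∀ (e : Edge 4 L) (i j : Fin 3), i ≠ j → (fundamentalRep (Fin 3)) (U e) i j = 0)
    (hflux : ∀ y : TorusSite 4 L, (fundamentalRep (Fin 3)) (plaquetteHolonomy U y 0 1) =
      Matrix.diagonal ![Complex.exp (Complex.I * θ), Complex.exp (-(Complex.I * θ)), 1])
    (hflat : ∀ (y : TorusSite 4 L) (μ ν : Fin 4), ¬(μ = 0 ∧ ν = 1) → ¬(μ = 1 ∧ ν = 0) →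
      plaquetteHolonomy U y μ ν = 1)
    (a : Fin 3) (z : Site 4) (μ ν : Fin 4) :
    (fundamentalRep (Fin 3)) (U ((fun ν' => ((z ν' : ℤ) : ZMod L)), μ)) a a *
        (fundamentalRep (Fin 3)) (U ((fun ν' => (((z + Pi.single μ 1 : Site 4) ν' : ℤ) : ZMod L)), ν)) a a *
        conj ((fundamentalRep (Fin 3)) (U ((fun ν' => (((z + Pi.single ν 1 : Site 4) ν' : ℤ) : ZMod L)), μ)) a a) *
        conj ((fundamentalRep (Fin 3)) (U ((fun ν' => ((z ν' : ℤ) : ZMod L)), ν)) a a) =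
      if μ = 0 ∧ ν = 1 then Complex.exp (Complex.I * (charge a θ : ℝ))
      else if μ = 1 ∧ ν = 0 then Complex.exp (-(Complex.I * (charge a θ : ℝ))) else 1 := by
  rw [castSite_add_single, castSite_add_single, ← plaquette_apply_diag U hdiag]
  have hcharge : (Matrix.diagonal ![Complex.exp (Complex.I * θ), Complex.exp (-(Complex.I * θ)), 1]) a a =
      Complex.exp (Complex.I * (charge a θ : ℝ)) := by
    rw [Matrix.diagonal_apply_eq]
    fin_cases a
    · simp [charge]
    · simp only [charge]; simp
    · simp [charge]
  split_ifs with h01 h10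
  · obtain ⟨rfl, rfl⟩ := h01
    rw [hflux, hcharge]
  · obtain ⟨rfl, rfl⟩ := h10
    -- the `(1,0)` plaquette is the inverse of the `(0,1)` one
    have hswap : plaquetteHolonomy U (fun ν' => ((z ν' : ℤ) : ZMod L)) 1 0 =
        (plaquetteHolonomy U (fun ν' => ((z ν' : ℤ) : ZMod L)) 0 1)⁻¹ := by
      simp only [plaquetteHolonomy, mul_inv_rev, inv_inv, mul_assoc]
    have hinv_apply : ∀ (g : Matrix.specialUnitaryGroup (Fin 3) ℂ) (i j : Fin 3),
        (fundamentalRep (Fin 3)) g⁻¹ i j = conj ((fundamentalRep (Fin 3)) g j i) := fun _ _ _ => rfl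
    rw [hswap, hinv_apply, hflux, hcharge, ← Complex.exp_conj, map_mul,
      Complex.conj_I, Complex.conj_ofReal, neg_mul]
  · rw [hflat _ μ ν h01 h10, map_one, Matrix.one_apply_eq]

end Diagonal

end TorusToPlane

/-! ### The stub -/

open TorusToPlane in
/-- **Stub `stub_torusToPlane`** of line `Sketch` (crux `QuarkLoopCoefficient`): under the crux
hypotheses, for every `t ≥ 0`, site `x`, colour `a` and spin `α`, the on-site diagonal entry of the
torus heat kernel is a twisted periodization of the symmetric-gauge heat symbol of charge
`charge a θ` over the deck group `Lℤ⁴`,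
`K_U(t)((x,a,α),(x,a,α)) = Σ_{n∈ℤ⁴} c_n · (symHeat (charge a θ) t (L·n))_{αα}`, `c_0 = 1`, `|c_n| = 1`.
Proof: colour decoupling and periodization through the exponential series
(`hasSum_heatKer_deck`), the abelian gauge classification of the pulled-back phases on `ℤ⁴`
(`pullback_plaquette`, `exists_gauge_symLink`), conjugation covariance (`heatKer_gauge`) and
magnetic-translation covariance of the symmetric gauge (`heatKer_symLink`); the unit phases
`c_n = g(x̃) conj g(x̃ + Ln) · Ω(x̃, Ln)` collect the gauge and the magnetic cocycle. -/
theorem stub_torusToPlane :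
    (∀ (L : ℕ) [NeZero L] (U : GaugeConfig 4 L (Matrix.specialUnitaryGroup (Fin 3) ℂ)) (θ : ℝ),
        (∀ (e : Edge 4 L) (i j : Fin 3), i ≠ j → (fundamentalRep (Fin 3)) (U e) i j = 0) →
        (∀ y : TorusSite 4 L, (fundamentalRep (Fin 3)) (plaquetteHolonomy U y 0 1) =
            Matrix.diagonal ![Complex.exp (Complex.I * θ), Complex.exp (-(Complex.I * θ)), 1]) →
        (∀ (y : TorusSite 4 L) (μ ν : Fin 4), ¬(μ = 0 ∧ ν = 1) → ¬(μ = 1 ∧ ν = 0) →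
            plaquetteHolonomy U y μ ν = 1) →
        ∀ (t : ℝ), 0 ≤ t → ∀ (x : TorusSite 4 L) (a : Fin 3) (α : Fin 4),
          ∃ c : Site 4 → ℂ, c 0 = 1 ∧ (∀ n, ‖c n‖ = 1) ∧
            HasSum (fun n : Site 4 => c n * symHeat (charge a θ) t (fun μ => (L : ℤ) * n μ) α α)
              (torusHeat U t (x, a, α) (x, a, α))) := by
  intro L _ U θ hdiag hflux hflat t _ x a α
  -- a lift `x̃` of `x`
  set xt : Site 4 := fun ν => ((x ν).val : ℤ) with hxt
  have hx : (fun ν => ((xt ν : ℤ) : ZMod L)) = x := by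
    funext ν; simp [hxt]
  -- the pulled-back colour-`a` phases and their gauge classification
  have hunit : ∀ e : ZdEdge 4,
      ‖(fundamentalRep (Fin 3)) (U ((fun ν => ((e.1 ν : ℤ) : ZMod L)), e.2)) a a‖ = 1 :=
    fun e => TorusToPlane.norm_apply_diag U hdiag _ a
  obtain ⟨g, hg, hgauge⟩ := TorusToPlane.exists_gauge_symLink
    (fun e : ZdEdge 4 => (fundamentalRep (Fin 3)) (U ((fun ν => ((e.1 ν : ℤ) : ZMod L)), e.2)) a a)
    (charge a θ) hunit (fun z μ ν => TorusToPlane.pullback_plaquette U θ hdiag hflux hflat a z μ ν)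
  -- the unit-modulus twists
  refine ⟨fun n => g xt * conj (g (xt + fun μ => (L : ℤ) * n μ)) *
      Complex.exp (((charge a θ / 2 * (wedge xt (fun μ => (L : ℤ) * n μ) : ℝ) : ℝ) : ℂ) * Complex.I),
    ?_, ?_, ?_⟩
  · -- `c 0 = 1`
    have h0 : (fun μ : Fin 4 => (L : ℤ) * (0 : Site 4) μ) = 0 := by funext μ; simp
    beta_reduce
    rw [h0, add_zero, Complex.mul_conj', hg, TorusToPlane.wedge_zero_right]
    simp
  · -- `|c n| = 1`
    intro n
    rw [norm_mul, norm_mul, RCLike.norm_conj, hg, hg, Complex.norm_exp_ofReal_mul_I]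
    simp
  · -- the periodization, then gauge and magnetic-translation covariance termwise
    have hdeck := TorusToPlane.hasSum_heatKer_deck U hdiag t xt a α xt α
    rw [hx] at hdeck
    refine hdeck.congr_fun fun n => ?_
    rw [hgauge, TorusToPlane.heatKer_gauge hg, TorusToPlane.heatKer_symLink, add_sub_cancel_left,
      Matrix.smul_apply, Matrix.smul_apply, smul_eq_mul, smul_eq_mul]
    ring

end Summit.QuantumFields.QCD.Cruxes.QuarkLoopCoefficient.Sketch

end
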